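import Summits.Parity.GeneralizedHardyLittlewood.Theorems.PrimeLevelFamEdgeMomentsBeyondDiagonalFarLayersBox
import Summits.Parity.GeneralizedHardyLittlewood.Theorems.PrimeLevelFamEdgeMomentsBeyondDiagonalTwoOrderIdentification
import Summits.Parity.GeneralizedHardyLittlewood.Theorems.PrimeLevelFamEdgeMomentsBeyondDiagonalFirstMomentAllQ
import HarnessLib

/-!
# Route `PrimeLevelFamEdge`, crux K_A `MomentsBeyondDiagonal` (stmt-Parity-20007), line «petersson_layers» v4:
# THE FAR PETERSSON LAYERS BEYOND THE WEIL CUT HAVE THE PRINTED SHAPE — `SubFar ρ` for every cut `ρ ≥ ρ_W`, PROVED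

Deck 21b (`…PeterssonLayersHeart` §5b) names the WEIL CUT `ρ_W(Δ') = 4Δ' − 3/2` as «the provable tail instance»: the layers
`r > q̂^{4Δ'−3/2}` total `≤ q̂^{3/4+ε}` by Weil's bound, `|J₁(x)| ≤ x/2` and absolute convergence. This file PROVES it, for every
`P, Q` (admissibility, parity and the genericity `q̂^{Δ'} ∉ ℕ` are not used), with main-term functional `t = 0`:
* §1 `one_add_log_pow_mul_rpow_neg_le`: `(1+log x)^d x^{−3/40} ≤ K_d (log x)⁻³` (`x ≥ e`);
* §2 `norm_farLayers_le`: for every cut `ρ` with `ρ(Δ') ≥ 4Δ' − 3/2` on `(1, 3/2]`: `∃ C ∀ Δ' ∈ (1,3/2] ∀ prime q ≥ 324`,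
  `‖FAR(ρ)‖ = ‖Σ_{q̂^{ρ} < r ≤ q⁸} K_r‖ ≤ C q̂ (log q̂)⁻³` (kernel-linearity of `spectralSum`, the order sum with
  `|ℓ^{−(i+j)}| ≤ 1`, the per-order far box bound `FarLayers.norm_farBox₂_le`, `1 + 2 log q ≤ 9(1 + log q̂)`);
* §3 **`subFar_of_ge_rhoWeil`**, **`subFar_rhoWeil : SubFar rhoWeil`** — the far piece of the v2 SIX-SPLIT OF RECORD
  `MomentsBeyondDiagonal_of_sixSplitWeil`, unconditionally;
* §4 glue on the window `(1, 3/2]`: `farLayers ρ_P = band ρ_P ρ_W + farLayers ρ_W`, `subOf_of_add_window`, hence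
  **`subFar_rhoP_of_band : SubBand rhoP rhoWeil → SubFar rhoP`** — the registered stub `stub_farP : SubFar rhoP` is REDUCED to
  the print band `(ρ_P, ρ_W]` alone (Pascadi, arXiv:2511.08445, Thm 7.1, applied in pencil by deck 21c; NOT typed, NOT proved
  here), its Weil part being discharged;
* §5 corollaries with the landed stubs `stub_first` (p803664) and `stub_identP` (p795653, transported to `ρ_W`):
  `SubTail ρ_W` (`subTail_rhoWeil`: `Q^h = D − HEART(ρ_W) + O(q̂ log⁻³ q̂)` with explicit `D`, `HEART`),
  `KA ⟸ SubDiag ∧ SubHeart ρ_W` (`momentsBeyondDiagonal_of_diag_heartWeil`), `KA ⟸ SubDiag ∧ SubRung ∧ SubUpper ρ_W`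
  (`momentsBeyondDiagonal_of_diag_rung_upperWeil`) and the v4 line with `stub_farP` replaced by the print band
  (`momentsBeyondDiagonal_of_bands`).
* §6 `norm_QhPQ_sub_diagPart_add_heart_le`: for every `P, Q`, uniformly on `(1, 3/2]` and primes `q ≥ 324`,
  `‖Q^h(P,Q)(q̂^{Δ'}) − (D − HEART(ρ_W))‖ ≤ C q̂ (log q̂)⁻³` — the explicit form of the second display's content beyond the diagonal.
HONESTY: `stub_farP` is NOT closed (the band `(ρ_P, ρ_W]` is conjecture/print-grade bilinear Kloosterman cancellation, not a
fixed-pair statement); `stub_diag`, `stub_rung`, `stub_core`, `stub_band` untouched; K_A, K_B and the Parity summit are NOT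
proved; nothing about Landau–Siegel zeros.
-/

noncomputable section

open scoped Real Nat
open Complex Finset Polynomial MeasureTheory
open Literature.NumberTheory.LFunctions

namespace Summit.Parity.GeneralizedHardyLittlewood.Theorems.MomentsBeyondDiagonal.FarLayers

open Summit.Parity.GeneralizedHardyLittlewood.Theses.PrimeLevelFamEdge (MomentsBeyondDiagonal)
open Summit.Parity.GeneralizedHardyLittlewood.Theorems.PrimeLevelFamEdgeIdeaDeltas.PairsSplit (SubFirst)
open Summit.Parity.GeneralizedHardyLittlewood.Theorems.PrimeLevelFamEdgeIdeaDeltas.PeterssonLayers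
open Summit.Parity.GeneralizedHardyLittlewood.Theorems.MomentsBeyondDiagonal.TwoOrderAFE
  (one_add_two_log_le exp_one_le_qhat stub_identP norm_one_add_neg_one_pow_le)
open Summit.Parity.GeneralizedHardyLittlewood.Theorems.MomentsBeyondDiagonal.FirstOrderAFE (stub_first)

/-! ## §1. Polylog against the power saving -/

/-- `(1 + log x)^d · x^{−3/40} ≤ K_d · (log x)⁻³` for `x ≥ e`, `K_d = 2^d ((40(d+3))/3)^{d+3}`
(`1 + log x ≤ 2 log x`, `log x ≤ x^ε/ε` at `ε = 3/(40(d+3))`). -/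
theorem one_add_log_pow_mul_rpow_neg_le (d : ℕ) :
    ∃ K : ℝ, 0 ≤ K ∧ ∀ x : ℝ, Real.exp 1 ≤ x →
      (1 + Real.log x) ^ d * x ^ (-(3 / 40 : ℝ)) ≤ K * (Real.log x)⁻¹ ^ 3 := by
  set ε : ℝ := (3 / 40) / ((d : ℝ) + 3) with hεdef
  have hε : 0 < ε := by rw [hεdef]; positivity
  refine ⟨2 ^ d * ε⁻¹ ^ (d + 3), by positivity, fun x hx ↦ ?_⟩
  have hx1 : 1 ≤ x := le_trans (by have := Real.add_one_le_exp (1 : ℝ); linarith) hx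
  have hx0 : 0 < x := by linarith
  have hlog1 : 1 ≤ Real.log x := by rwa [Real.le_log_iff_exp_le hx0]
  have hlog0 : 0 < Real.log x := by linarith
  have h1 : (1 + Real.log x) ^ d ≤ 2 ^ d * Real.log x ^ d := by
    rw [← mul_pow]
    exact pow_le_pow_left₀ (by linarith) (by linarith) d
  have h2 : Real.log x ^ (d + 3) ≤ ε⁻¹ ^ (d + 3) * x ^ (3 / 40 : ℝ) := by
    have hl : Real.log x ≤ x ^ ε / ε := Real.log_le_rpow_div hx0.le hε
    have hexp : ε * ((d + 3 : ℕ) : ℝ) = 3 / 40 := by rw [hεdef]; push_cast; field_simp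
    calc Real.log x ^ (d + 3) ≤ (x ^ ε / ε) ^ (d + 3) := pow_le_pow_left₀ hlog0.le hl _
      _ = ε⁻¹ ^ (d + 3) * (x ^ ε) ^ (d + 3) := by rw [div_eq_mul_inv, mul_pow]; ring
      _ = ε⁻¹ ^ (d + 3) * x ^ (3 / 40 : ℝ) := by
          rw [← Real.rpow_natCast (x ^ ε) (d + 3), ← Real.rpow_mul hx0.le, hexp]
  have hx340 : 0 < x ^ (3 / 40 : ℝ) := Real.rpow_pos_of_pos hx0 _
  have hneg : x ^ (-(3 / 40 : ℝ)) = (x ^ (3 / 40 : ℝ))⁻¹ := Real.rpow_neg hx0.le _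
  have hKeq : (2 : ℝ) ^ d * ε⁻¹ ^ (d + 3) * (Real.log x)⁻¹ ^ 3 = (2 ^ d * ε⁻¹ ^ (d + 3)) / Real.log x ^ 3 := by
    simp only [inv_pow, div_eq_mul_inv]
  rw [hKeq, le_div_iff₀ (pow_pos hlog0 3), hneg]
  rw [show (1 + Real.log x) ^ d * (x ^ (3 / 40 : ℝ))⁻¹ * Real.log x ^ 3 =
      ((1 + Real.log x) ^ d * Real.log x ^ 3) / x ^ (3 / 40 : ℝ) by ring, div_le_iff₀ hx340]
  calc (1 + Real.log x) ^ d * Real.log x ^ 3 ≤ 2 ^ d * Real.log x ^ d * Real.log x ^ 3 :=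
        mul_le_mul_of_nonneg_right h1 (pow_nonneg hlog0.le 3)
    _ = 2 ^ d * Real.log x ^ (d + 3) := by rw [pow_add]; ring
    _ ≤ 2 ^ d * (ε⁻¹ ^ (d + 3) * x ^ (3 / 40 : ℝ)) := mul_le_mul_of_nonneg_left h2 (by positivity)
    _ = 2 ^ d * ε⁻¹ ^ (d + 3) * x ^ (3 / 40 : ℝ) := by ring

/-! ## §2. The far layers are `O(q̂ log⁻³ q̂)` beyond the Weil cut -/

/-- `FAR(ρ)` is the spectral sum against the summed layer kernel `Σ_{R < r ≤ q⁸} K_r-kernel`. -/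
theorem farLayers_eq_spectralSum (q : ℕ) [NeZero q] (ρ : ℝ → ℝ) (P Q : ℝ[X]) (Δ' : ℝ) :
    farLayers q ρ P Q Δ' =
      spectralSum q P Q Δ' (fun a b ↦ ∑ r ∈ Icc (layerCount q ρ Δ' + 1) (q ^ 8), layerKernel q r a b) := by
  unfold farLayers layer
  rw [spectralSum_kernel_finset_sum]

/-- `R + 1 ≥ q̂^{ρ(Δ')}` for `R = ⌊q̂^{ρ(Δ')}⌋`, hence `≥ q̂^{4Δ'−3/2}` once `ρ(Δ') ≥ 4Δ' − 3/2` (`q ≥ 64`). -/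
theorem rpow_le_layerCount_add_one {q : ℕ} [NeZero q] (hq : 64 ≤ q) {ρ : ℝ → ℝ} {Δ' : ℝ}
    (hρ : 4 * Δ' - 3 / 2 ≤ ρ Δ') :
    KMV2000.qhat q ^ (4 * Δ' - 3 / 2) ≤ (((layerCount q ρ Δ' + 1 : ℕ)) : ℝ) := by
  have h1 : 1 < KMV2000.qhat q := one_lt_qhat hq
  calc KMV2000.qhat q ^ (4 * Δ' - 3 / 2) ≤ KMV2000.qhat q ^ ρ Δ' := Real.rpow_le_rpow_of_exponent_le h1.le hρ
    _ ≤ (((layerCount q ρ Δ' + 1 : ℕ)) : ℝ) := by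
        unfold layerCount
        push_cast
        exact (Nat.lt_floor_add_one _).le

/-- **§2. THE FAR LAYERS BEYOND THE WEIL CUT (every `P, Q`, `q` prime).** For every cut `ρ` with `ρ(Δ') ≥ 4Δ' − 3/2` on
`(1, 3/2]` there is `C` with `‖Σ_{q̂^{ρ} < r ≤ q⁸} K_r‖ ≤ C q̂ (log q̂)⁻³` for all `Δ' ∈ (1, 3/2]` and all primes `q ≥ 324`
(Weil's bound, `|J₁(x)| ≤ x/2`, the decay of `W_{ij}`, absolute convergence: deck 21b §5b THE COUNT at the Weil cut).
[cite: KowalskiMichelVanderKam2000, (21)–(22) p. 12; KowalskiMichel2000, §2.4.2 p. 312 (23); Iwaniec2002, §2.5 (2.25)] -/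
theorem norm_farLayers_le (P Q : ℝ[X]) (ρ : ℝ → ℝ)
    (hρ : ∀ Δ' : ℝ, 1 < Δ' → Δ' ≤ 3 / 2 → 4 * Δ' - 3 / 2 ≤ ρ Δ') :
    ∃ C : ℝ, ∀ Δ' : ℝ, 1 < Δ' → Δ' ≤ 3 / 2 → ∀ (q : ℕ) [NeZero q], q.Prime → 324 ≤ q →
      ‖farLayers q ρ P Q Δ'‖ ≤ C * KMV2000.qhat q * (Real.log (KMV2000.qhat q))⁻¹ ^ 3 := by
  choose A hA0 hA using fun i j ↦ norm_farBox₂_le P i j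
  set d : ℕ := Q.natDegree with hd
  obtain ⟨K, hK0, hK⟩ := one_add_log_pow_mul_rpow_neg_le (4 * d)
  set As : ℝ := ∑ i ∈ range (d + 1), ∑ j ∈ range (d + 1), |Q.coeff i| * |Q.coeff j| * A i j with hAs
  have hAs0 : 0 ≤ As := Finset.sum_nonneg fun i _ ↦ Finset.sum_nonneg fun j _ ↦
    mul_nonneg (mul_nonneg (abs_nonneg _) (abs_nonneg _)) (hA0 i j)
  refine ⟨As * 2 * 9 ^ (2 * d) * K, fun Δ' h1 h32 q _ hq h324 ↦ ?_⟩
  have h64 : 64 ≤ q := le_trans (by norm_num) h324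
  have h0 : 0 < Δ' := by linarith
  have hqh1 : 1 < KMV2000.qhat q := one_lt_qhat h64
  have hqh0 : 0 < KMV2000.qhat q := zero_lt_one.trans hqh1
  have hqe : Real.exp 1 ≤ KMV2000.qhat q := exp_one_le_qhat h324
  have hlog1 : 1 ≤ Real.log (KMV2000.qhat q) := by rwa [Real.le_log_iff_exp_le hqh0]
  have hlog0 : 0 < Real.log (KMV2000.qhat q) := by linarith
  set x : ℝ := 1 + Real.log (KMV2000.qhat q) with hxdef
  have hx2 : 2 ≤ x := by rw [hxdef]; linarith
  set R : ℕ := layerCount q ρ Δ' with hRdef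
  have hR : KMV2000.qhat q ^ (4 * Δ' - 3 / 2) ≤ (((R + 1 : ℕ)) : ℝ) :=
    rpow_le_layerCount_add_one h64 (hρ Δ' h1 h32)
  rw [farLayers_eq_spectralSum]
  unfold spectralSum
  -- per-term bound
  have hℓ : 0 ≤ (Real.log (KMV2000.qhat q))⁻¹ := inv_nonneg.mpr hlog0.le
  have hℓ1 : (Real.log (KMV2000.qhat q))⁻¹ ≤ 1 := inv_le_one_of_one_le₀ hlog1
  have hLij : ∀ i ∈ range (d + 1), ∀ j ∈ range (d + 1),
      ((1 + Real.log (KMV2000.qhat q)) * (1 + 2 * Real.log q)) ^ (i + j) ≤ 9 ^ (2 * d) * x ^ (4 * d) := by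
    intro i hi j hj
    have hi' : i ≤ d := Nat.lt_succ_iff.mp (Finset.mem_range.mp hi)
    have hj' : j ≤ d := Nat.lt_succ_iff.mp (Finset.mem_range.mp hj)
    have h9 := one_add_two_log_le (q := q) h64
    calc ((1 + Real.log (KMV2000.qhat q)) * (1 + 2 * Real.log q)) ^ (i + j)
        ≤ (x * (9 * x)) ^ (i + j) := by
          refine pow_le_pow_left₀ (by positivity) ?_ _
          rw [hxdef]
          exact mul_le_mul_of_nonneg_left h9 (by positivity)
      _ = (9 * x ^ 2) ^ (i + j) := by ring
      _ ≤ (9 * x ^ 2) ^ (2 * d) := pow_le_pow_right₀ (by nlinarith) (by omega)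
      _ = 9 ^ (2 * d) * x ^ (4 * d) := by rw [mul_pow, ← pow_mul]; ring_nf
  have hq2 : ‖(KMV2000.qhat q : ℂ)‖ = KMV2000.qhat q := by
    rw [Complex.norm_real, Real.norm_eq_abs, abs_of_pos hqh0]
  have hterm : ∀ i ∈ range (d + 1), ∀ j ∈ range (d + 1),
      ‖(Q.coeff i : ℂ) * (Q.coeff j : ℂ) * (((Real.log (KMV2000.qhat q))⁻¹ : ℝ) : ℂ) ^ (i + j) *
          (1 + (-1 : ℂ) ^ (i + j)) * (KMV2000.qhat q : ℂ) *
          ∑ n₁ ∈ afeBox q, ∑ n₂ ∈ afeBox q,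
            ((((n₁ : ℝ) * n₂) ^ (-(1 / 2 : ℝ)) : ℝ) : ℂ) * afeW (KMV2000.qhat q) i j n₁ n₂ *
            ∑ m₁ ∈ Icc 1 ⌊KMV2000.qhat q ^ Δ'⌋₊, ∑ m₂ ∈ Icc 1 ⌊KMV2000.qhat q ^ Δ'⌋₊,
              (KMV2000.mollifierCoeff P (KMV2000.qhat q ^ Δ') m₁ : ℂ) *
                (KMV2000.mollifierCoeff P (KMV2000.qhat q ^ Δ') m₂ : ℂ) *
              ∑ d₁ ∈ (Nat.gcd m₁ n₁).divisors, ∑ d₂ ∈ (Nat.gcd m₂ n₂).divisors,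
                ∑ r ∈ Icc (R + 1) (q ^ 8), layerKernel q r (m₁ * n₁ / d₁ ^ 2) (m₂ * n₂ / d₂ ^ 2)‖ ≤
        |Q.coeff i| * |Q.coeff j| * A i j * (2 * (9 ^ (2 * d) * (x ^ (4 * d) * KMV2000.qhat q ^ (-(3 / 40 : ℝ)))) *
          KMV2000.qhat q) := by
    intro i hi j hj
    have hg := hA i j q hq h64 Δ' h0 h32 R hR
    simp only [afeW_eq_kmv] at hg ⊢
    rw [norm_mul, norm_mul, norm_mul, norm_mul, norm_mul, norm_pow, Complex.norm_real, Complex.norm_real,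
      Complex.norm_real, Real.norm_eq_abs, Real.norm_eq_abs, Real.norm_eq_abs, abs_of_nonneg hℓ, hq2]
    have hpow : (Real.log (KMV2000.qhat q))⁻¹ ^ (i + j) ≤ 1 := pow_le_one₀ hℓ hℓ1
    have hsgn := norm_one_add_neg_one_pow_le (i + j)
    have hx4 : 0 ≤ x ^ (4 * d) * KMV2000.qhat q ^ (-(3 / 40 : ℝ)) := by positivity
    calc |Q.coeff i| * |Q.coeff j| * (Real.log (KMV2000.qhat q))⁻¹ ^ (i + j) * ‖(1 + (-1 : ℂ) ^ (i + j))‖ *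
          KMV2000.qhat q * _
        ≤ |Q.coeff i| * |Q.coeff j| * 1 * 2 * KMV2000.qhat q *
            (A i j * ((1 + Real.log (KMV2000.qhat q)) * (1 + 2 * Real.log q)) ^ (i + j) *
              KMV2000.qhat q ^ (-(3 / 40 : ℝ))) := by
          gcongr
      _ ≤ |Q.coeff i| * |Q.coeff j| * 1 * 2 * KMV2000.qhat q *
            (A i j * (9 ^ (2 * d) * x ^ (4 * d)) * KMV2000.qhat q ^ (-(3 / 40 : ℝ))) := by
          gcongr
          · exact hA0 i j
          · exact hLij i hi j hj
      _ = _ := by ring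
  have hx := hK (KMV2000.qhat q) hqe
  calc _ ≤ ∑ i ∈ range (d + 1), ∑ j ∈ range (d + 1), |Q.coeff i| * |Q.coeff j| * A i j *
          (2 * (9 ^ (2 * d) * (x ^ (4 * d) * KMV2000.qhat q ^ (-(3 / 40 : ℝ)))) * KMV2000.qhat q) := by
        refine (norm_sum_le _ _).trans (Finset.sum_le_sum fun i hi ↦ ?_)
        exact (norm_sum_le _ _).trans (Finset.sum_le_sum fun j hj ↦ hterm i hi j hj)
    _ = As * 2 * 9 ^ (2 * d) * (x ^ (4 * d) * KMV2000.qhat q ^ (-(3 / 40 : ℝ))) * KMV2000.qhat q := by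
        rw [hAs, Finset.sum_mul, Finset.sum_mul, Finset.sum_mul, Finset.sum_mul]
        refine Finset.sum_congr rfl fun i _ ↦ ?_
        rw [Finset.sum_mul, Finset.sum_mul, Finset.sum_mul, Finset.sum_mul]
        refine Finset.sum_congr rfl fun j _ ↦ ?_
        ring
    _ ≤ As * 2 * 9 ^ (2 * d) * (K * (Real.log (KMV2000.qhat q))⁻¹ ^ 3) * KMV2000.qhat q := by
        rw [hxdef]; gcongr
    _ = As * 2 * 9 ^ (2 * d) * K * KMV2000.qhat q * (Real.log (KMV2000.qhat q))⁻¹ ^ 3 := by ring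

/-! ## §3. `SubFar ρ` for every cut at or above the Weil cut -/

/-- **`SubFar ρ` for every cut `ρ ≥ ρ_W` on `(1, 3/2]` (PROVED; window `(1, 3/2]`, functional `t = 0`, threshold `324`).** -/
theorem subFar_of_ge_rhoWeil (ρ : ℝ → ℝ) (hρ : ∀ Δ' : ℝ, 1 < Δ' → Δ' ≤ 3 / 2 → 4 * Δ' - 3 / 2 ≤ ρ Δ') :
    SubFar ρ := by
  refine ⟨3 / 2, by norm_num, fun _ _ _ ↦ 0, fun P Q _ _ Δ' h1 h32 ↦ ?_⟩
  obtain ⟨C, hC⟩ := norm_farLayers_le P Q ρ hρ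
  refine ⟨C, 324, fun q _ hq hq₀ _ ↦ ?_⟩
  have h := hC Δ' h1 h32 q hq hq₀
  simpa using h

/-- **THE FAR PIECE OF THE SIX-SPLIT OF RECORD: `SubFar rhoWeil` (PROVED)** — deck 21b §5b's «provable tail instance», the
layers `r > q̂^{4Δ'−3/2}`, unconditionally (Weil + `|J₁(x)| ≤ x/2` + the decay of `W_{ij}`).
[cite: KowalskiMichelVanderKam2000, (21)–(22) p. 12; KowalskiMichel2000, §2.4.2 p. 312 (23); Iwaniec2002, §2.5 (2.25)] -/
theorem subFar_rhoWeil : SubFar rhoWeil :=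
  subFar_of_ge_rhoWeil rhoWeil fun Δ' _ _ ↦ by unfold rhoWeil; exact le_rfl

/-! ## §4. Glue on the window `(1, 3/2]`: the print-cut far layers = the print band + the Weil-cut far layers -/

/-- `FAR(ρ₁) = BAND(ρ₁, ρ₂) + FAR(ρ₂)` whenever `⌊q̂^{ρ₁}⌋ ≤ ⌊q̂^{ρ₂}⌋ ≤ q⁸` (disjoint layer ranges). -/
theorem farLayers_eq_band_add_farLayers (q : ℕ) [NeZero q] (ρ₁ ρ₂ : ℝ → ℝ) (P Q : ℝ[X]) (Δ' : ℝ)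
    (h₁₂ : layerCount q ρ₁ Δ' ≤ layerCount q ρ₂ Δ') (h₂ : layerCount q ρ₂ Δ' ≤ q ^ 8) :
    farLayers q ρ₁ P Q Δ' = band q ρ₁ ρ₂ P Q Δ' + farLayers q ρ₂ P Q Δ' := by
  unfold farLayers band
  have hU : Icc (layerCount q ρ₁ Δ' + 1) (q ^ 8) =
      Icc (layerCount q ρ₁ Δ' + 1) (layerCount q ρ₂ Δ') ∪ Icc (layerCount q ρ₂ Δ' + 1) (q ^ 8) := by
    ext r
    simp only [mem_Icc, mem_union]
    omega
  have hD : Disjoint (Icc (layerCount q ρ₁ Δ' + 1) (layerCount q ρ₂ Δ')) (Icc (layerCount q ρ₂ Δ' + 1) (q ^ 8)) := by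
    rw [Finset.disjoint_left]
    intro r hr hr'
    simp only [mem_Icc] at hr hr'
    omega
  rw [hU, sum_union hD]

/-- **TWO-PIECE GLUE ON A WINDOW**: if `H = R + U` for `q ≥ 64` and `Δ' ∈ (1, Δ₀]` (`Δ₀ > 1`), then
`SubOf R → SubOf U → SubOf H` (`t_H := t_R + t_U`, windows intersected with `(1, Δ₀]`). -/
theorem subOf_of_add_window (H R U : LevelFamily) {Δ₀ : ℝ} (hΔ₀ : 1 < Δ₀)
    (hsplit : ∀ (q : ℕ) [NeZero q] (P Q : ℝ[X]) (Δ' : ℝ), 1 < Δ' → Δ' ≤ Δ₀ → 64 ≤ q →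
      H q P Q Δ' = R q P Q Δ' + U q P Q Δ') :
    SubOf R → SubOf U → SubOf H := by
  rintro ⟨Δ₁, h₁, tr, H₁⟩ ⟨Δ₂, h₂, tu, H₂⟩
  refine ⟨min (min Δ₁ Δ₂) Δ₀, lt_min (lt_min h₁ h₂) hΔ₀, fun Δ' P Q ↦ tr Δ' P Q + tu Δ' P Q, ?_⟩
  intro P Q hP hQ Δ hlo hhi
  have hΔ₀' : Δ ≤ Δ₀ := hhi.trans (min_le_right _ _)
  obtain ⟨C₁, q₁, HH₁⟩ := H₁ P Q hP hQ Δ hlo (hhi.trans ((min_le_left _ _).trans (min_le_left _ _)))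
  obtain ⟨C₂, q₂, HH₂⟩ := H₂ P Q hP hQ Δ hlo (hhi.trans ((min_le_left _ _).trans (min_le_right _ _)))
  refine ⟨C₁ + C₂, max (max q₁ q₂) 64, fun q _ hq hq₀ hM ↦ ?_⟩
  have h64 : 64 ≤ q := le_trans (le_max_right _ _) hq₀
  have hr := HH₁ q hq (le_trans (le_max_left _ _) (le_trans (le_max_left _ _) hq₀)) hM
  have hu := HH₂ q hq (le_trans (le_max_right _ _) (le_trans (le_max_left _ _) hq₀)) hM
  rw [hsplit q P Q Δ hlo hΔ₀' h64]
  set N₂ : ℂ := (2 * riemannZeta 2 ^ 2 *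
      ((KMV2000.qhat q / (Δ ^ 2 * Real.log (KMV2000.qhat q) ^ 2) : ℝ) : ℂ)) with hN₂
  have e : R q P Q Δ + U q P Q Δ - N₂ * ((tr Δ P Q + tu Δ P Q : ℝ) : ℂ) =
      (R q P Q Δ - N₂ * ((tr Δ P Q : ℝ) : ℂ)) + (U q P Q Δ - N₂ * ((tu Δ P Q : ℝ) : ℂ)) := by
    push_cast
    ring
  rw [e]
  calc ‖(R q P Q Δ - N₂ * ((tr Δ P Q : ℝ) : ℂ)) + (U q P Q Δ - N₂ * ((tu Δ P Q : ℝ) : ℂ))‖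
      ≤ ‖R q P Q Δ - N₂ * ((tr Δ P Q : ℝ) : ℂ)‖ + ‖U q P Q Δ - N₂ * ((tu Δ P Q : ℝ) : ℂ)‖ := norm_add_le _ _
    _ ≤ C₁ * KMV2000.qhat q * (Real.log (KMV2000.qhat q))⁻¹ ^ 3 +
          C₂ * KMV2000.qhat q * (Real.log (KMV2000.qhat q))⁻¹ ^ 3 := add_le_add hr hu
    _ = (C₁ + C₂) * KMV2000.qhat q * (Real.log (KMV2000.qhat q))⁻¹ ^ 3 := by ring

/-- **FAR GLUE at the two cuts of record: `SubBand rhoP rhoWeil → SubFar rhoWeil → SubFar rhoP`** (window `(1, 3/2]`, where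
`ρ_P < ρ_W ≤ 8`). -/
theorem subFar_of_band_far : SubBand rhoP rhoWeil → SubFar rhoWeil → SubFar rhoP :=
  subOf_of_add_window (fun q _ P Q Δ' ↦ farLayers q rhoP P Q Δ') (fun q _ P Q Δ' ↦ band q rhoP rhoWeil P Q Δ')
    (fun q _ P Q Δ' ↦ farLayers q rhoWeil P Q Δ') (Δ₀ := 3 / 2) (by norm_num)
    (fun q _ P Q Δ' h1 h32 h64 ↦ farLayers_eq_band_add_farLayers q rhoP rhoWeil P Q Δ'
      (layerCount_mono h64 (rhoP_lt_rhoWeil Δ' h1 (by linarith)).le)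
      (layerCount_le_pow_eight h64 (rhoWeil_le_eight Δ' h1 h32)))

/-- **THE REGISTERED STUB `stub_farP : SubFar rhoP` REDUCED TO THE PRINT BAND (PROVED reduction):
`SubBand rhoP rhoWeil → SubFar rhoP`** — the Weil part `r > q̂^{ρ_W}` is `subFar_rhoWeil`; what remains is the band
`q̂^{ρ_P} < r ≤ q̂^{ρ_W}` (Pascadi, arXiv:2511.08445, Thm 7.1, applied in pencil by deck 21c; not typed, not proved here). -/
theorem subFar_rhoP_of_band (h : SubBand rhoP rhoWeil) : SubFar rhoP :=
  subFar_of_band_far h subFar_rhoWeil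

/-! ## §5. Corollaries with the landed stubs -/

/-- **K_A from THREE explicit pieces (PROVED glue + landed satellites):** `SubDiag → SubRung → SubUpper ρ_W → K_A` — the
six-split of record `MomentsBeyondDiagonal_of_sixSplitWeil` with `SubFirst` (`stub_first`, p803664), `TailNearFar ρ_W`
(`stub_identP`, p795653, transported by `tailNearFar_rhoWeil_of_rhoP`) and `SubFar ρ_W` (`subFar_rhoWeil`) discharged.
The three remaining pieces contain the wall (BN-7a); nothing here bounds them. -/
theorem momentsBeyondDiagonal_of_diag_rung_upperWeil : SubDiag → SubRung → SubUpper rhoWeil → KA :=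
  fun h₂ h₃ h₄ ↦ MomentsBeyondDiagonal_of_sixSplitWeil stub_first h₂ h₃ h₄
    (tailNearFar_rhoWeil_of_rhoP stub_identP) subFar_rhoWeil

/-- **The difference-defined TAIL at the Weil cut has the printed shape (PROVED): `SubTail rhoWeil`** — i.e. on a window
beyond the diagonal `Q^h(P,Q)(q̂^{Δ'}) = D − HEART(ρ_W) + O(q̂ log⁻³ q̂)` with `D`, `HEART(ρ_W) = Σ_{r ≤ q̂^{4Δ'−3/2}} K_r` the
explicit cusp-form-free pieces of deck 21a (identification `stub_identP` transported to `ρ_W` + `subFar_rhoWeil`). -/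
theorem subTail_rhoWeil : SubTail rhoWeil :=
  subTail_of_ident_far rhoWeil (tailNearFar_rhoWeil_of_rhoP stub_identP) subFar_rhoWeil

/-- **K_A from TWO explicit pieces (PROVED glue + landed satellites):** `SubDiag → SubHeart ρ_W → K_A`
(`MomentsBeyondDiagonal_of_layerSplit ρ_W` with `stub_first` and `subTail_rhoWeil`). -/
theorem momentsBeyondDiagonal_of_diag_heartWeil : SubDiag → SubHeart rhoWeil → KA :=
  fun h₂ h₃ ↦ MomentsBeyondDiagonal_of_layerSplit rhoWeil stub_first h₂ h₃ subTail_rhoWeil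

/-- **The v4 line with `stub_farP` replaced by the print band (PROVED glue):**
`SubDiag → SubRung → SubUpper ρ_c → SubBand ρ_c ρ_P → SubBand ρ_P ρ_W → K_A`. -/
theorem momentsBeyondDiagonal_of_bands :
    SubDiag → SubRung → SubUpper rhoCore → SubBand rhoCore rhoP → SubBand rhoP rhoWeil → KA :=
  fun h₂ h₃ h₄ h₅ h₆ ↦ MomentsBeyondDiagonal_of_sevenSplitBands stub_first h₂ h₃ h₄ h₅ stub_identP
    (subFar_rhoP_of_band h₆)

/-! ## §6. The explicit second moment beyond the diagonal, up to the printed error (every `P, Q`) -/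

/-- **`Q^h(P,Q)(q̂^{Δ'}) = D − HEART(ρ_W) + O(q̂ log⁻³ q̂)`, EXPLICITLY and UNIFORMLY (PROVED):** for every real `P, Q` there
is `C` such that for all `Δ' ∈ (1, 3/2]` and all primes `q ≥ 324`,
`‖Q^h(P,Q)(q̂^{Δ'}) − (diagPart − Σ_{r ≤ q̂^{4Δ'−3/2}} layer r)‖ ≤ C q̂ (log q̂)⁻³` — the identification at every `Q`
(`tailNearFar_allQ`, p795653: two-order AFE ∘ Hecke ∘ Petersson, Weil for `r > q⁸`, `W_{ij}`-decay off the box) plus the Weil-cut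
far layers (`norm_farLayers_le`). Beyond the diagonal the mollified second harmonic moment IS its explicit cusp-form-free
diagonal minus its first `q̂^{4Δ'−3/2}` explicit Petersson layers, to the printed accuracy; K_A is thus EXACTLY the statement that
`D − HEART(ρ_W)` has a level-free main term (`momentsBeyondDiagonal_of_diag_heartWeil`). Nothing here bounds the heart.
[cite: KowalskiMichelVanderKam2000, (21)–(22) p. 12, Lemma 3.1 (10) p. 8; KowalskiMichel2000, §2.4.2 p. 312 (23); Iwaniec2002, §2.5 (2.25)] -/
theorem norm_QhPQ_sub_diagPart_add_heart_le (P Q : ℝ[X]) :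
    ∃ C : ℝ, ∀ Δ' : ℝ, 1 < Δ' → Δ' ≤ 3 / 2 → ∀ (q : ℕ) [NeZero q], q.Prime → 324 ≤ q →
      ‖KMV2000.QhPQ q P Q (KMV2000.qhat q ^ Δ') - (diagPart q P Q Δ' - heart q rhoWeil P Q Δ')‖ ≤
        C * KMV2000.qhat q * (Real.log (KMV2000.qhat q))⁻¹ ^ 3 := by
  obtain ⟨C₁, hC₁⟩ := TwoOrderAFE.tailNearFar_allQ P Q rhoWeil (fun Δ' h₁ h₂ ↦ rhoWeil_le_eight Δ' h₁ h₂)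
  obtain ⟨C₂, hC₂⟩ := norm_farLayers_le P Q rhoWeil (fun Δ' _ _ ↦ by unfold rhoWeil; exact le_rfl)
  refine ⟨C₁ + C₂, fun Δ' h1 h32 q _ hq h324 ↦ ?_⟩
  have h₁ := hC₁ Δ' h1 h32 q hq h324
  have h₂ := hC₂ Δ' h1 h32 q hq h324
  have e : KMV2000.QhPQ q P Q (KMV2000.qhat q ^ Δ') - (diagPart q P Q Δ' - heart q rhoWeil P Q Δ') =
      (tail q rhoWeil P Q Δ' - -farLayers q rhoWeil P Q Δ') - farLayers q rhoWeil P Q Δ' := by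
    unfold tail
    ring
  rw [e]
  calc ‖(tail q rhoWeil P Q Δ' - -farLayers q rhoWeil P Q Δ') - farLayers q rhoWeil P Q Δ'‖
      ≤ ‖tail q rhoWeil P Q Δ' - -farLayers q rhoWeil P Q Δ'‖ + ‖farLayers q rhoWeil P Q Δ'‖ := norm_sub_le _ _
    _ ≤ C₁ * KMV2000.qhat q * (Real.log (KMV2000.qhat q))⁻¹ ^ 3 +
          C₂ * KMV2000.qhat q * (Real.log (KMV2000.qhat q))⁻¹ ^ 3 := add_le_add h₁ h₂
    _ = (C₁ + C₂) * KMV2000.qhat q * (Real.log (KMV2000.qhat q))⁻¹ ^ 3 := by ring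

end Summit.Parity.GeneralizedHardyLittlewood.Theorems.MomentsBeyondDiagonal.FarLayers

end
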